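import Literature.RepresentationTheory.FiniteGroups.MonomialCharacters
import Literature.RepresentationTheory.FiniteGroups.MonomialRepresentation
import HarnessLib

/-!
# Virtual characters of degree zero are `ℤ`-combinations of `Ind_H^G (α - 1)` (Serre, Ex. 10.6)

Topic `Literature/RepresentationTheory/FiniteGroups`.  Let `G` be a finite group, `R(G)` its ring
of virtual characters (`virtChars G`, `RepresentationRing`) and `R₀(G) = {f ∈ R(G) | f(1) = 0}`
the virtual characters of degree `0`.  Serre, *Linear Representations of Finite Groups*, §10.5,
Exercise 10.6 ("suggested by A. Weil"): *each `f ∈ R(G)` with `f(1) = 0` is a `ℤ`-linear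
combination of elements `Ind_E^G (α - 1)`, `E ≤ G` an (elementary) subgroup and `α` a
character of degree `1` of `E`.*  This is the degree-zero refinement of Brauer's induction
theorem on which the uniqueness of the Langlands–Deligne local constants rests (Deligne, *Les
constantes des équations fonctionnelles des fonctions L*, Antwerp II, LNM 349 (1973), Thm. 4.1:
`ε` is determined by the one-dimensional case, additivity and inductivity in degree `0` — a
virtual representation of degree `0` which is an integral combination of `Ind (α - 1)`'s has its
`ε` pinned by these rules).

Everything here is **proved** (no named facts).  Main results:

* `degZeroMonomialSpan G` — the additive subgroup `R'₀(G)` of `G → ℂ` generated by the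
  `Ind_H^G (α - 1)` (`indClassFun`), `H ≤ G`, `α : H →* ℂˣ`;
* `mem_degZeroMonomialSpan_of_mem_virtChars` — **`R₀(G) ⊆ R'₀(G)`**: every virtual character
  vanishing at `1` lies in `R'₀(G)`; with the easy converse, `mem_degZeroMonomialSpan_iff`:
  `f ∈ R'₀(G) ↔ f ∈ R(G) ∧ f 1 = 0`;
* `exists_sum_indClassFun_sub_one` — the same as an explicit finite `ℤ`-combination
  `f = ∑ᵢ nᵢ · Ind_{Hᵢ}^G (αᵢ - 1)`.

Compared with the printed exercise the subgroups `Hᵢ` are arbitrary, not necessarily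
elementary (the weaker conclusion; it is the form consumed by the local-constants argument).

## Proof (Serre's hints (a)–(d), with Thm. 16's induction in place of (c))

(a) `Ind_K^G` maps `R'₀(K)` into `R'₀(G)` (transitivity of induction,
`indClassFun_indClassFun_map`), and `R'₀` pulls back along `G → G/N` (`indClassFun_comp_mk`).
(b) For `N ⊲ G` with `G/N` abelian, `Ind_N^G 1 - (G:N)·1 ∈ R'₀(G)`: `Ind_N^G 1` is the pull-back
of the regular character `Ind_1^{G/N} 1` of the abelian group `G/N`, a sum of characters `χ` of
degree `1`, and `χ - 1 = Ind_{G/N}^{G/N}(χ - 1)`.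
(c) `G` nilpotent, by induction on `|G|` along the proof of Serre §8.5 Thm. 16
(`IsCharacter.isMonomialSum_of_isNilpotent`): for an irreducible character `χ`, either `G` is
abelian (then `χ - 1` is a generator), or `χ` factors through a proper quotient (pull back), or
`χ` is faithful and, by §8.1 Prop. 24 (`exists_indClassFun_of_not_homothety`), `χ = Ind_H^G θ`
with `H < G`; a proper subgroup of a finite nilpotent group lies in a normal subgroup `M ≠ G`
with `G/M` abelian (`exists_le_normal_isMulCommutative_quotient`, from the normaliser condition),
so `χ = Ind_M^G ψ`, `ψ = Ind_H^M θ ∈ R(M)`, and `χ - χ(1) = Ind_M^G (ψ - ψ(1)) + ψ(1) (Ind_M^G 1 -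
(G:M))` with both terms in `R'₀(G)` by induction, (a) and (b).
(d) General `G`: by Brauer's theorem in the elementary form (`brauer_induction_elementary_holds`,
Serre §10.5 Thm. 19) `1 = ∑ nᵢ Ind_{Hᵢ}^G φᵢ` with `Hᵢ` elementary, hence nilpotent
(`IsElementary.isNilpotent`), so `f = f · 1 = ∑ nᵢ Ind_{Hᵢ}^G (φᵢ · Res f)` (projection formula,
`indClassFun_mul_mem_of_mem_virtChars`) with `φᵢ · Res f ∈ R₀(Hᵢ) ⊆ R'₀(Hᵢ)` by (c); conclude
by (a).

## Mathlib search

Mathlib (this pin) has `Group.normalizerCondition_of_isNilpotent`, `Group.IsNilpotent.center_ne_bot`,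
`IsCoatom`, `Finite.to_isCoatomic`, `QuotientGroup`, but no representation ring, no induction of
class functions and no Brauer theorem (see `BrauerInduction`); nothing here duplicates a Mathlib
declaration.  The Literature files `RepresentationRing`, `BrauerTheorem`, `MonomialCharacters`,
`InductionTransitivity` supply `virtChars`, `indClassFun` and its calculus, Brauer's Thm. 19 and
Serre's Prop. 24 / Thm. 16.

## References

* J.-P. Serre, *Linear Representations of Finite Groups*, GTM 42 (1977), §8.1 Prop. 24, §8.5
  Thm. 16, §10.5 Thm. 19 and Exercise 10.6 (`SerreLinearRepresentations1977`).
* P. Deligne, *Les constantes des équations fonctionnelles des fonctions L*, in Modular Functions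
  of One Variable II, LNM 349 (1973), 501–597, §4 Thm. 4.1 (`Deligne1973`; context only, not
  cited by any declaration here).
-/

noncomputable section

open scoped BigOperators

namespace Literature.RepresentationTheory.FiniteGroups

variable {G : Type} [Group G]

/-! ### Complements on induced class functions and virtual characters -/

section Complements

variable [Fintype G] (H : Subgroup G)

/-- `Ind_H^G (-φ) = -Ind_H^G φ` (linearity of induction). [folklore] -/
theorem indClassFun_neg (φ : H → ℂ) : indClassFun H (-φ) = -indClassFun H φ := by
  rw [← neg_one_smul ℂ φ, indClassFun_smul, neg_one_smul]

/-- `Ind_H^G (φ - ψ) = Ind_H^G φ - Ind_H^G ψ` (linearity of induction). [folklore] -/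
theorem indClassFun_sub (φ ψ : H → ℂ) :
    indClassFun H (φ - ψ) = indClassFun H φ - indClassFun H ψ := by
  rw [sub_eq_add_neg, indClassFun_add, indClassFun_neg, ← sub_eq_add_neg]

/-- `Ind_H^G φ (1) = 0` when `φ(1) = 0` (`Ind φ (1) = (G:H) φ(1)`, Serre §7.2).
[cite: SerreLinearRepresentations1977, §7.2] -/
theorem indClassFun_apply_one_eq_zero {φ : H → ℂ} (h : φ 1 = 0) : indClassFun H φ 1 = 0 := by
  rw [indClassFun_one, show (⟨1, H.one_mem⟩ : H) = 1 from rfl, h, mul_zero, mul_zero]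

variable {H}

omit [Fintype G] in
/-- Characters transport along group isomorphisms: if `χ` is a character of `K` and
`e : K' ≃* K`, then `χ ∘ e` is a character of `K'` (of `ρ ∘ e`). [folklore] -/
theorem IsCharacter.comp_mulEquiv' {K K' : Type} [Group K] [Group K'] {χ : K → ℂ}
    (hχ : IsCharacter K χ) (e : K' ≃* K) : IsCharacter K' (fun x => χ (e x)) := by
  obtain ⟨V, _, _, _, ρ, rfl⟩ := hχ
  exact ⟨V, _, _, inferInstance, ρ.comp e.toMonoidHom, rfl⟩

omit [Fintype G] in
/-- Virtual characters take integer values at `1` (an irreducible character takes the value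
`dim` there, Serre §2.1 Prop. 1). [cite: SerreLinearRepresentations1977, §2.1 Prop. 1] -/
theorem exists_int_apply_one_of_mem_virtChars [Finite G] {f : G → ℂ} (hf : f ∈ virtChars G) :
    ∃ n : ℤ, f 1 = (n : ℂ) := by
  refine AddSubgroup.closure_induction (p := fun g _ => ∃ n : ℤ, g 1 = (n : ℂ)) ?_ ?_ ?_ ?_ hf
  · rintro χ ⟨V, _, _, _, ρ, -, rfl⟩
    exact ⟨Module.finrank ℂ V, by rw [Representation.char_one, Int.cast_natCast]⟩
  · exact ⟨0, by rw [Pi.zero_apply, Int.cast_zero]⟩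
  · rintro g g' _ _ ⟨n, hn⟩ ⟨n', hn'⟩
    exact ⟨n + n', by rw [Pi.add_apply, hn, hn', Int.cast_add]⟩
  · rintro g _ ⟨n, hn⟩
    exact ⟨-n, by rw [Pi.neg_apply, hn, Int.cast_neg]⟩

omit [Fintype G] in
/-- A character of degree `1`, `θ : G →* ℂˣ`, is a character (`IsCharacter`) — of the
one-dimensional representation `g ↦ θ(g) · id_ℂ` (Serre §1.2). [cite: SerreLinearRepresentations1977, §1.2] -/
theorem isCharacter_coe_monoidHom' (θ : G →* ℂˣ) : IsCharacter G (fun g => (θ g : ℂ)) := by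
  refine ⟨ℂ, _, _, inferInstance,
    (DistribMulAction.toModuleEnd ℂ ℂ).comp ((Units.coeHom ℂ).comp θ), funext fun g => ?_⟩
  show LinearMap.trace ℂ ℂ (DistribMulAction.toModuleEnd ℂ ℂ ((θ g : ℂˣ) : ℂ)) = (θ g : ℂ)
  have : DistribMulAction.toModuleEnd ℂ ℂ ((θ g : ℂˣ) : ℂ) = ((θ g : ℂˣ) : ℂ) • LinearMap.id := by
    ext
    simp
  rw [this, map_smul, LinearMap.trace_id, Module.finrank_self, Nat.cast_one, smul_eq_mul, mul_one]

omit [Fintype G] in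
/-- A character of degree `1` is a virtual character. [cite: SerreLinearRepresentations1977, §9.1] -/
theorem coe_monoidHom_mem_virtChars [Finite G] (θ : G →* ℂˣ) :
    (fun g => (θ g : ℂ)) ∈ virtChars G :=
  (isCharacter_coe_monoidHom' θ).mem_virtChars

end Complements

/-! ### The span `R'₀(G)` of the `Ind_H^G (α - 1)` -/

section Span

variable (G) [Fintype G]

/-- The generators `Ind_H^G (α - 1)` of Serre's `R'₀(G)`: `H ≤ G` a subgroup, `α : H →* ℂˣ` a
character of degree `1` of `H`, `1` the trivial character of `H`
(Serre, *Linear Representations*, §10.5 Ex. 10.6 (a), there with `H` elementary). [cite: SerreLinearRepresentations1977, §10.5 Ex. 10.6] -/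
def degZeroMonomialGens : Set (G → ℂ) :=
  {f | ∃ (H : Subgroup G) (α : H →* ℂˣ), f = indClassFun H (fun h => (α h : ℂ) - 1)}

/-- **`R'₀(G)`**: the additive subgroup of `G → ℂ` generated by the `Ind_H^G (α - 1)`, `H ≤ G`,
`α` a character of degree `1` of `H` (Serre, *Linear Representations*, §10.5 Ex. 10.6 (a):
"let `R'₀(G)` be the subgroup of `R(G)` generated by the `Ind_E^G (α - 1)`"; here `E` ranges over
all subgroups). [cite: SerreLinearRepresentations1977, §10.5 Ex. 10.6] -/
def degZeroMonomialSpan : AddSubgroup (G → ℂ) :=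
  AddSubgroup.closure (degZeroMonomialGens G)

variable {G}

/-- The generators lie in `R'₀(G)`. [cite: SerreLinearRepresentations1977, §10.5 Ex. 10.6] -/
theorem indClassFun_sub_one_mem (H : Subgroup G) (α : H →* ℂˣ) :
    indClassFun H (fun h => (α h : ℂ) - 1) ∈ degZeroMonomialSpan G :=
  AddSubgroup.subset_closure ⟨H, α, rfl⟩

/-- Elements of `R'₀(G)` vanish at `1` (`Ind_H^G (α - 1) (1) = (G:H)(α(1) - 1) = 0`).
[cite: SerreLinearRepresentations1977, §10.5 Ex. 10.6] -/
theorem apply_one_eq_zero_of_mem_degZeroMonomialSpan {f : G → ℂ}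
    (hf : f ∈ degZeroMonomialSpan G) : f 1 = 0 := by
  refine AddSubgroup.closure_induction (p := fun g _ => g 1 = 0) ?_ ?_ ?_ ?_ hf
  · rintro g ⟨H, α, rfl⟩
    exact indClassFun_apply_one_eq_zero H (by rw [map_one, Units.val_one, sub_self])
  · rfl
  · intro g g' _ _ hg hg'
    rw [Pi.add_apply, hg, hg', add_zero]
  · intro g _ hg
    rw [Pi.neg_apply, hg, neg_zero]

/-- `R'₀(G) ⊆ R(G)`: the generators are virtual characters (`Ind_H^G` maps `R(H)` to `R(G)`,
`indClassFun_mem_virtChars`). [cite: SerreLinearRepresentations1977, §10.5 Ex. 10.6] -/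
theorem mem_virtChars_of_mem_degZeroMonomialSpan {f : G → ℂ} (hf : f ∈ degZeroMonomialSpan G) :
    f ∈ virtChars G := by
  classical
  refine AddSubgroup.closure_induction (p := fun g _ => g ∈ virtChars G) ?_ (Subring.zero_mem _)
    (fun _ _ _ _ hg hg' => Subring.add_mem _ hg hg') (fun _ _ hg => Subring.neg_mem _ hg) hf
  rintro g ⟨H, α, rfl⟩
  refine indClassFun_mem_virtChars H (Subring.sub_mem _ (coe_monoidHom_mem_virtChars α) ?_)
  exact Subring.one_mem _

/-- **(a) Transitivity**: `Ind_K^G` maps `R'₀(K)` into `R'₀(G)`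
(`Ind_K^G (Ind_{H₀}^K (α - 1)) = Ind_{H₀}^G (α - 1)`, `indClassFun_indClassFun_map`).
[cite: SerreLinearRepresentations1977, §10.5 Ex. 10.6 (a)] -/
theorem indClassFun_mem_degZeroMonomialSpan (K : Subgroup G) [Fintype K] {f : K → ℂ}
    (hf : f ∈ degZeroMonomialSpan K) : indClassFun K f ∈ degZeroMonomialSpan G := by
  refine AddSubgroup.closure_induction (p := fun g _ => indClassFun K g ∈ degZeroMonomialSpan G)
    ?_ ?_ ?_ ?_ hf
  · rintro g ⟨H₀, α, rfl⟩
    rw [indClassFun_indClassFun_map K H₀]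
    exact indClassFun_sub_one_mem (H₀.map K.subtype)
      (α.comp (Subgroup.equivMapOfInjective H₀ K.subtype K.subtype_injective).symm.toMonoidHom)
  · rw [indClassFun_zero]
    exact zero_mem _
  · intro g g' _ _ hg hg'
    rw [indClassFun_add]
    exact add_mem hg hg'
  · intro g _ hg
    rw [indClassFun_neg]
    exact neg_mem hg

/-- **(a') Pull-back**: for `N ⊲ G`, composition with `G → G/N` maps `R'₀(G/N)` into `R'₀(G)`
(`(Ind_{H̄}^{G/N} (α - 1)) ∘ π = Ind_{π⁻¹H̄}^G (α ∘ π - 1)`, `indClassFun_comp_mk`). [folklore] -/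
theorem comp_mk_mem_degZeroMonomialSpan (N : Subgroup G) [N.Normal] [Fintype (G ⧸ N)]
    {φ : G ⧸ N → ℂ} (hφ : φ ∈ degZeroMonomialSpan (G ⧸ N)) :
    (fun g : G => φ g) ∈ degZeroMonomialSpan G := by
  refine AddSubgroup.closure_induction
    (p := fun ψ _ => (fun g : G => ψ g) ∈ degZeroMonomialSpan G) ?_ (zero_mem _)
    (fun _ _ _ _ h h' => add_mem h h') (fun _ _ h => neg_mem h) hφ
  rintro ψ ⟨Hb, α, rfl⟩
  have : (fun g : G => indClassFun Hb (fun h => (α h : ℂ) - 1) (g : G ⧸ N)) =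
      indClassFun (Hb.comap (QuotientGroup.mk' N))
        (fun h => ((α.comp ((QuotientGroup.mk' N).subgroupComap Hb)) h : ℂ) - 1) := by
    funext g
    exact (indClassFun_comp_mk N Hb (fun h => (α h : ℂ) - 1) g).symm
  rw [this]
  exact indClassFun_sub_one_mem _ _

/-- `R'₀`-membership of `f - f(1)` is additive in `f`: it passes from the irreducible characters
to all of `R(G)`. [folklore] -/
theorem sub_apply_one_mem_degZeroMonomialSpan_of_forall_isIrrChar
    (hirr : ∀ χ : G → ℂ, IsIrrChar G χ → (fun g => χ g - χ 1) ∈ degZeroMonomialSpan G)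
    {f : G → ℂ} (hf : f ∈ virtChars G) : (fun g => f g - f 1) ∈ degZeroMonomialSpan G := by
  refine AddSubgroup.closure_induction
    (p := fun g _ => (fun s => g s - g 1) ∈ degZeroMonomialSpan G) hirr ?_ ?_ ?_ hf
  · have : (fun s : G => (0 : G → ℂ) s - (0 : G → ℂ) 1) = 0 := by
      funext s; simp
    rw [this]
    exact zero_mem _
  · intro g g' _ _ hg hg'
    have : (fun s : G => (g + g') s - (g + g') 1) = (fun s => g s - g 1) + fun s => g' s - g' 1 := by
      funext s; simp only [Pi.add_apply]; ring
    rw [this]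
    exact add_mem hg hg'
  · intro g _ hg
    have : (fun s : G => (-g) s - (-g) 1) = -fun s => g s - g 1 := by
      funext s; simp only [Pi.neg_apply]; ring
    rw [this]
    exact neg_mem hg

/-- From `f - f(1) ∈ R'₀(G)` for all `f ∈ R(G)` to `R₀(G) ⊆ R'₀(G)`. [folklore] -/
theorem mem_degZeroMonomialSpan_of_forall_isIrrChar
    (hirr : ∀ χ : G → ℂ, IsIrrChar G χ → (fun g => χ g - χ 1) ∈ degZeroMonomialSpan G)
    {f : G → ℂ} (hf : f ∈ virtChars G) (h1 : f 1 = 0) : f ∈ degZeroMonomialSpan G := by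
  simpa [h1] using sub_apply_one_mem_degZeroMonomialSpan_of_forall_isIrrChar hirr hf

/-! ### (b) Abelian groups and normal subgroups with abelian quotient -/

/-- For an irreducible character `χ` of a finite **abelian** group, `χ - 1 ∈ R'₀(G)`: `χ` has
degree `1` (`IsIrrChar.map_mul`, `IsIrrChar.map_one`) and `χ - 1 = Ind_G^G (χ - 1)` is a
generator. [cite: SerreLinearRepresentations1977, §10.5 Ex. 10.6 (b)] -/
theorem sub_one_mem_degZeroMonomialSpan_of_isIrrChar [IsMulCommutative G] {χ : G → ℂ}
    (hχ : IsIrrChar G χ) : χ - 1 ∈ degZeroMonomialSpan G := by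
  let θ : G →* ℂ := ⟨⟨χ, hχ.map_one⟩, hχ.map_mul⟩
  have hclass : IsClassFun (χ - 1) := fun s t => by
    simp only [Pi.sub_apply, Pi.one_apply, hχ.isCharacter.isClassFun s t]
  have key : indClassFun (⊤ : Subgroup G)
      (fun h => (((θ.toHomUnits.comp (Subgroup.subtype ⊤)) h : ℂˣ) : ℂ) - 1) = χ - 1 := by
    funext s
    rw [← indClassFun_top_apply hclass s]
    congr 1
  rw [← key]
  exact indClassFun_sub_one_mem ⊤ _

/-- Hence, for a finite abelian group, `f - f(1) ∈ R'₀(G)` for every `f ∈ R(G)`.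
[cite: SerreLinearRepresentations1977, §10.5 Ex. 10.6 (b)] -/
theorem sub_apply_one_mem_degZeroMonomialSpan_of_isMulCommutative [IsMulCommutative G]
    {f : G → ℂ} (hf : f ∈ virtChars G) : (fun g => f g - f 1) ∈ degZeroMonomialSpan G := by
  refine sub_apply_one_mem_degZeroMonomialSpan_of_forall_isIrrChar (fun χ hχ => ?_) hf
  have : (fun g => χ g - χ 1) = χ - 1 := by
    funext g; rw [hχ.map_one]; rfl
  rw [this]
  exact sub_one_mem_degZeroMonomialSpan_of_isIrrChar hχ

/-- **(b)** For a normal subgroup `N` with **abelian** quotient `G/N`, the permutation character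
`Ind_N^G 1` satisfies `Ind_N^G 1 - (Ind_N^G 1)(1) · 1 ∈ R'₀(G)` (and `(Ind_N^G 1)(1) = (G:N)`):
`Ind_N^G 1 = (Ind_1^{G/N} 1) ∘ π` is the pull-back of a character of the abelian group `G/N`
(Serre: "`Ind_H^G (1)` is the sum of `(G:H)` characters of degree `1` of `G` whose kernel
contains `H`"). [cite: SerreLinearRepresentations1977, §10.5 Ex. 10.6 (b)] -/
theorem indClassFun_one_sub_mem_degZeroMonomialSpan (N : Subgroup G) [N.Normal]
    [IsMulCommutative (G ⧸ N)] :
    (fun g => indClassFun N (fun _ => (1 : ℂ)) g - indClassFun N (fun _ => (1 : ℂ)) 1) ∈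
      degZeroMonomialSpan G := by
  classical
  -- the regular character of `G/N` as an induced function, a character of `G/N`
  set P : G ⧸ N → ℂ := indClassFun (⊥ : Subgroup (G ⧸ N)) (fun _ => (1 : ℂ)) with hP
  have hPchar : IsCharacter (G ⧸ N) P := by
    have h := isCharacter_indClassFun_monoidHom (⊥ : Subgroup (G ⧸ N)) 1
    have hfun : (fun h : (⊥ : Subgroup (G ⧸ N)) => (((1 : (⊥ : Subgroup (G ⧸ N)) →* ℂˣ) h : ℂˣ) : ℂ))
        = fun _ => (1 : ℂ) := by
      funext h; simp
    rwa [hfun] at h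
  have hPmem : (fun q => P q - P 1) ∈ degZeroMonomialSpan (G ⧸ N) :=
    sub_apply_one_mem_degZeroMonomialSpan_of_isMulCommutative hPchar.mem_virtChars
  have hpull := comp_mk_mem_degZeroMonomialSpan N hPmem
  -- `P ∘ π = Ind_N^G 1`
  have hsub : (⊥ : Subgroup (G ⧸ N)).comap (QuotientGroup.mk' N) = N := by
    rw [MonoidHom.comap_bot, QuotientGroup.ker_mk']
  have hcomp : ∀ g : G, P (g : G ⧸ N) = indClassFun N (fun _ => (1 : ℂ)) g := by
    intro g
    rw [hP, ← indClassFun_comp_mk N ⊥ (fun _ => (1 : ℂ)) g]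
    exact congrFun (indClassFun_congr_subgroup hsub
      ((fun _ => (1 : ℂ)) ∘ (QuotientGroup.mk' N).subgroupComap ⊥) (fun _ => (1 : ℂ))
      fun _ _ _ => rfl) g
  have hfun : (fun g : G => (fun q => P q - P 1) (g : G ⧸ N)) =
      fun g => indClassFun N (fun _ => (1 : ℂ)) g - indClassFun N (fun _ => (1 : ℂ)) 1 := by
    funext g
    simp only [hcomp g, ← QuotientGroup.mk_one, hcomp 1]
  rwa [hfun] at hpull

/-- The value `(Ind_N^G 1)(1) = (G:N)`. [cite: SerreLinearRepresentations1977, §7.2] -/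
theorem indClassFun_const_one_apply_one (N : Subgroup G) :
    indClassFun N (fun _ => (1 : ℂ)) 1 = N.index := by
  classical
  rw [indClassFun_one, mul_one, ← Nat.card_eq_fintype_card, ← Subgroup.card_mul_index N,
    Nat.cast_mul, inv_mul_cancel_left₀ (Nat.cast_ne_zero.mpr Nat.card_pos.ne')]

end Span

/-! ### A group-theoretic lemma on finite nilpotent groups -/

/-- In a finite nilpotent group every proper subgroup `H` is contained in a proper **normal**
subgroup `M` with **abelian** quotient `G/M` (take `M` maximal containing `H`: by the normaliser
condition `M` is normal, and `G/M`, nilpotent without proper non-trivial subgroups, equals its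
centre).  Serre, §10.5 Ex. 10.6 (c): "if `H ∈ Y` [maximal], then `H` is normal in `G`, and `G/H`
has prime order [use the fact that `G` is nilpotent]". [cite: SerreLinearRepresentations1977, §10.5 Ex. 10.6 (c)] -/
theorem exists_le_normal_isMulCommutative_quotient [Finite G] [Group.IsNilpotent G]
    {H : Subgroup G} (hH : H ≠ ⊤) :
    ∃ (M : Subgroup G) (_ : M.Normal), H ≤ M ∧ M ≠ ⊤ ∧ IsMulCommutative (G ⧸ M) := by
  haveI : Finite (Subgroup G) :=
    Finite.of_injective (fun K : Subgroup G => (K : Set G)) SetLike.coe_injective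
  obtain ⟨M, hM, hHM⟩ := (eq_top_or_exists_le_coatom H).resolve_left hH
  have hlt : M < Subgroup.normalizer (M : Set G) :=
    Group.normalizerCondition_of_isNilpotent M hM.1.lt_top
  haveI hMn : M.Normal := Subgroup.normalizer_eq_top_iff.mp (hM.lt_iff.mp hlt)
  refine ⟨M, hMn, hHM, hM.1, ?_⟩
  -- `G/M` is nilpotent and non-trivial, so its centre is non-trivial; by maximality it is all
  haveI : Nontrivial (G ⧸ M) := QuotientGroup.nontrivial_iff.mpr hM.1
  have hZ : Subgroup.center (G ⧸ M) ≠ ⊥ := Group.IsNilpotent.center_ne_bot (G ⧸ M)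
  have hsurj : Function.Surjective (QuotientGroup.mk' M) := QuotientGroup.mk'_surjective M
  set C := (Subgroup.center (G ⧸ M)).comap (QuotientGroup.mk' M) with hC
  have hMC : M ≤ C := by
    intro m hm
    rw [hC, Subgroup.mem_comap, QuotientGroup.mk'_apply, (QuotientGroup.eq_one_iff m).mpr hm]
    exact one_mem _
  have hCtop : C = ⊤ := by
    rcases hMC.lt_or_eq with h | h
    · exact hM.lt_iff.mp h
    · exfalso
      apply hZ
      rw [← Subgroup.map_comap_eq_self_of_surjective hsurj (Subgroup.center (G ⧸ M)), ← hC, ← h,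
        Subgroup.map_eq_bot_iff, QuotientGroup.ker_mk']
  have hZtop : Subgroup.center (G ⧸ M) = ⊤ := by
    rw [← Subgroup.map_comap_eq_self_of_surjective hsurj (Subgroup.center (G ⧸ M)), ← hC, hCtop,
      Subgroup.map_top_of_surjective _ hsurj]
  exact ⟨⟨fun a b => Subgroup.mem_center_iff.mp (by rw [hZtop]; exact Subgroup.mem_top b) a⟩⟩

/-! ### (c) Nilpotent groups -/

section Nilpotent

/-- Induction on the order behind `IsIrrChar.sub_apply_one_mem_degZeroMonomialSpan`: for an
irreducible character `χ` of a nilpotent group of order `≤ n`, `χ - χ(1) ∈ R'₀` (the three cases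
of the proof of Serre §8.5 Thm. 16: abelian; non-trivial kernel; faithful, via Prop. 24).
[cite: SerreLinearRepresentations1977, §10.5 Ex. 10.6 (c)] -/
theorem sub_apply_one_mem_degZeroMonomialSpan_aux (n : ℕ) :
    ∀ (K : Type) [Group K] [Fintype K] [Group.IsNilpotent K] (χ : K → ℂ),
      Fintype.card K ≤ n → IsIrrChar K χ → (fun g => χ g - χ 1) ∈ degZeroMonomialSpan K := by
  induction n with
  | zero =>
    intro K _ _ _ χ hcard _
    exact absurd hcard (not_le.mpr Fintype.card_pos)
  | succ n ih =>
    intro K _ _ _ χ hcard hχ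
    classical
    -- `f - f(1) ∈ R'₀(K')` for nilpotent `K'` of smaller order and `f ∈ R(K')`
    have ihR : ∀ (K' : Type) [Group K'] [Fintype K'] [Group.IsNilpotent K'] (f : K' → ℂ),
        Fintype.card K' < Fintype.card K → f ∈ virtChars K' →
          (fun g => f g - f 1) ∈ degZeroMonomialSpan K' := by
      intro K' _ _ _ f hlt hf
      exact sub_apply_one_mem_degZeroMonomialSpan_of_forall_isIrrChar
        (fun χ' hχ' => ih K' χ' (by omega) hχ') hf
    obtain ⟨V, _, _, _, ρ, hirr, rfl⟩ := hχ
    by_cases hZ : Subgroup.center K = ⊤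
    · -- `K` abelian: `χ` has degree `1` and `χ - 1` is a generator
      haveI : IsMulCommutative K := ⟨⟨fun a b =>
        Subgroup.mem_center_iff.mp (by rw [hZ]; exact Subgroup.mem_top b) a⟩⟩
      have hirrc : IsIrrChar K ρ.character := ⟨V, _, _, inferInstance, ρ, hirr, rfl⟩
      have : (fun g => ρ.character g - ρ.character 1) = ρ.character - 1 := by
        funext g; rw [hirrc.map_one]; rfl
      rw [this]
      exact sub_one_mem_degZeroMonomialSpan_of_isIrrChar hirrc
    · by_cases hK : MonoidHom.ker ρ = ⊥
      · -- faithful, non-abelian: Prop. 24 gives `χ = Ind_H^K θ` with `H < K`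
        obtain ⟨A, hAn, hAc, a, haA, haZ⟩ := exists_normal_abelian_not_le_center hZ
        haveI := hAn
        haveI := hAc
        haveI := hirr
        have hns : ∃ a : A, ∀ c : ℂ, (ρ a : V →ₗ[ℂ] V) ≠ c • LinearMap.id :=
          ⟨⟨a, haA⟩, fun c => Representation.not_homothety_of_ker_eq_bot ρ hK haZ c⟩
        obtain ⟨H, hHtop, θ, hθ, hχθ⟩ := exists_indClassFun_of_not_homothety ρ A hns
        -- a proper normal `M ⊇ H` with abelian quotient
        obtain ⟨M, hMn, hHM, hMtop, hMc⟩ := exists_le_normal_isMulCommutative_quotient hHtop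
        haveI := hMn
        haveI := hMc
        -- `χ = Ind_M^K ψ` with `ψ = Ind_H^M θ ∈ R(M)`
        set ψ : M → ℂ := indClassFun (H.subgroupOf M) (toSubgroupOf H M θ) with hψ
        have hψmem : ψ ∈ virtChars M :=
          indClassFun_mem_virtChars _
            (IsCharacter.mem_virtChars (hθ.comp_mulEquiv' (Subgroup.subgroupOfEquivOfLe hHM)))
        have hχψ : ρ.character = indClassFun M ψ := by
          rw [hχθ, hψ, indClassFun_indClassFun H M hHM θ]
        have hcardM : Fintype.card M < Fintype.card K := by
          have hlt : Nat.card M < Nat.card K :=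
            lt_of_le_of_ne (Subgroup.card_le_card_group M)
              fun h => hMtop (Subgroup.eq_top_of_card_eq M h)
          rwa [Nat.card_eq_fintype_card, Nat.card_eq_fintype_card] at hlt
        -- `Ind_M^K (ψ - ψ(1)) ∈ R'₀(K)` by induction and transitivity
        have h1 : indClassFun M (fun m => ψ m - ψ 1) ∈ degZeroMonomialSpan K :=
          indClassFun_mem_degZeroMonomialSpan M (ihR M ψ hcardM hψmem)
        -- `ψ(1) ∈ ℤ`, so `ψ(1) · (Ind_M^K 1 - (K:M)) ∈ R'₀(K)` by (b)
        obtain ⟨k, hk⟩ := exists_int_apply_one_of_mem_virtChars hψmem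
        set P : K → ℂ := indClassFun M (fun _ => (1 : ℂ)) with hP
        have h2 : (k : ℂ) • (fun g => P g - P 1) ∈ degZeroMonomialSpan K := by
          rw [Int.cast_smul_eq_zsmul]
          exact AddSubgroup.zsmul_mem _ (indClassFun_one_sub_mem_degZeroMonomialSpan M) k
        -- combine: `χ - k · P(1) = Ind_M^K (ψ - ψ 1) + k · (P - P 1)`
        have hlin : indClassFun M (fun m => ψ m - ψ 1) = indClassFun M ψ - (k : ℂ) • P := by
          rw [show (fun m => ψ m - ψ 1) = ψ - (k : ℂ) • (fun _ => (1 : ℂ)) from ?_,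
            indClassFun_sub, indClassFun_smul]
          funext m
          simp [hk]
        have hsum : (fun g => ρ.character g - (k : ℂ) * P 1) =
            indClassFun M (fun m => ψ m - ψ 1) + (k : ℂ) • (fun g => P g - P 1) := by
          rw [hlin, ← hχψ]
          funext g
          simp only [Pi.add_apply, Pi.sub_apply, Pi.smul_apply, smul_eq_mul]
          ring
        have hmem : (fun g => ρ.character g - (k : ℂ) * P 1) ∈ degZeroMonomialSpan K := by
          rw [hsum]
          exact add_mem h1 h2
        -- the constant is `χ(1)`, since members of `R'₀(K)` vanish at `1`
        have h0 : ρ.character 1 - (k : ℂ) * P 1 = 0 :=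
          apply_one_eq_zero_of_mem_degZeroMonomialSpan hmem
        have hc : (k : ℂ) * P 1 = ρ.character 1 := (sub_eq_zero.mp h0).symm
        simpa only [hc] using hmem
      · -- non-trivial kernel: `χ` factors through `K / ker ρ`, pull back
        haveI : (MonoidHom.ker ρ).Normal := MonoidHom.normal_ker ρ
        obtain ⟨χb, hχb, hcomp⟩ :=
          Representation.exists_isCharacter_quotient ρ (MonoidHom.ker ρ) le_rfl
        have h1 : Nat.card K = Nat.card (K ⧸ MonoidHom.ker ρ) * Nat.card (MonoidHom.ker ρ) :=
          Subgroup.card_eq_card_quotient_mul_card_subgroup _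
        have h2 : 1 < Nat.card (MonoidHom.ker ρ) := (Subgroup.one_lt_card_iff_ne_bot _).mpr hK
        have h3 : Nat.card (K ⧸ MonoidHom.ker ρ) < Nat.card K := by
          rw [h1]; exact lt_mul_of_one_lt_right Nat.card_pos h2
        rw [Nat.card_eq_fintype_card, Nat.card_eq_fintype_card] at h3
        have hb := ihR (K ⧸ MonoidHom.ker ρ) χb h3 hχb.mem_virtChars
        have hpull := comp_mk_mem_degZeroMonomialSpan (MonoidHom.ker ρ) hb
        have hfun : (fun g : K => (fun q => χb q - χb 1) (g : K ⧸ MonoidHom.ker ρ)) =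
            fun g => ρ.character g - ρ.character 1 := by
          funext g
          simp only [hcomp g, hcomp 1, QuotientGroup.mk_one]
        rwa [hfun] at hpull

variable [Fintype G]

/-- **(c) Nilpotent groups, irreducible characters**: for an irreducible character `χ` of a finite
nilpotent group, `χ - χ(1) · 1 ∈ R'₀(G)`. [cite: SerreLinearRepresentations1977, §10.5 Ex. 10.6 (c)] -/
theorem IsIrrChar.sub_apply_one_mem_degZeroMonomialSpan [Group.IsNilpotent G] {χ : G → ℂ}
    (hχ : IsIrrChar G χ) : (fun g => χ g - χ 1) ∈ degZeroMonomialSpan G :=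
  sub_apply_one_mem_degZeroMonomialSpan_aux _ G χ le_rfl hχ

/-- **(c) Nilpotent groups**: `R₀(G) ⊆ R'₀(G)` for a finite nilpotent (e.g. elementary) group
`G` (Serre proves `R'(G) = R(G)` for `G` elementary). [cite: SerreLinearRepresentations1977, §10.5 Ex. 10.6 (c)] -/
theorem mem_degZeroMonomialSpan_of_isNilpotent [Group.IsNilpotent G] {f : G → ℂ}
    (hf : f ∈ virtChars G) (h1 : f 1 = 0) : f ∈ degZeroMonomialSpan G :=
  mem_degZeroMonomialSpan_of_forall_isIrrChar
    (fun _ hχ => hχ.sub_apply_one_mem_degZeroMonomialSpan) hf h1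

end Nilpotent

/-! ### (d) The theorem -/

section Main

variable [Fintype G]

/-- **Serre, *Linear Representations of Finite Groups*, §10.5 Exercise 10.6 (A. Weil)**: every
virtual character `f ∈ R(G)` of a finite group `G` with `f(1) = 0` is a `ℤ`-linear combination of
induced functions `Ind_H^G (α - 1)`, `H ≤ G`, `α` a character of degree `1` of `H`, i.e.
`R₀(G) ⊆ R'₀(G)` (`degZeroMonomialSpan`).  (Serre's exercise has moreover `H` elementary.)  Proof,
hint (d): by Brauer's Thm. 19 (`brauer_induction_elementary_holds`) `1 = ∑ nᵢ Ind_{Hᵢ}^G φᵢ`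
with `Hᵢ` elementary, so `f = ∑ nᵢ Ind_{Hᵢ}^G (φᵢ · Res f)` with `φᵢ · Res f ∈ R₀(Hᵢ)`, and
`R₀(Hᵢ) ⊆ R'₀(Hᵢ)` since `Hᵢ` is nilpotent (`mem_degZeroMonomialSpan_of_isNilpotent`).
[cite: SerreLinearRepresentations1977, §10.5 Ex. 10.6] -/
theorem mem_degZeroMonomialSpan_of_mem_virtChars {f : G → ℂ} (hf : f ∈ virtChars G)
    (h1 : f 1 = 0) : f ∈ degZeroMonomialSpan G := by
  classical
  obtain ⟨ι, _, H, φ, n, hH, hφ, heq⟩ := brauer_induction_elementary_holds G 1 isCharacter_one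
  -- `f = f · 1 = ∑ nᵢ (Ind φᵢ) · f`
  have hf' : f = ∑ i, (n i : ℂ) • (indClassFun (H i) (φ i) * f) := by
    conv_lhs => rw [← mul_one f, heq, Finset.mul_sum]
    refine Finset.sum_congr rfl fun i _ => ?_
    rw [mul_smul_comm, mul_comm]
  rw [hf']
  refine AddSubgroup.sum_mem _ fun i _ => ?_
  rw [Int.cast_smul_eq_zsmul]
  refine AddSubgroup.zsmul_mem _ ?_ _
  -- projection formula: `(Ind φᵢ) · f = Ind (φᵢ · Res f)` with `φᵢ · Res f ∈ R₀(Hᵢ)`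
  obtain ⟨hmem, hmul⟩ := indClassFun_mul_mem_of_mem_virtChars (H i) (hφ i).mem_virtChars hf
  rw [hmul]
  obtain ⟨p, hp, hel⟩ := hH i
  haveI : Group.IsNilpotent (H i) := hel.isNilpotent hp
  refine indClassFun_mem_degZeroMonomialSpan (H i) (mem_degZeroMonomialSpan_of_isNilpotent hmem ?_)
  rw [Pi.mul_apply, OneMemClass.coe_one, h1, mul_zero]

/-- **`R'₀(G) = R₀(G)`**: a function on the finite group `G` is a `ℤ`-combination of the
`Ind_H^G (α - 1)` iff it is a virtual character vanishing at `1`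
(Serre, §10.5 Ex. 10.6, with arbitrary subgroups `H`). [cite: SerreLinearRepresentations1977, §10.5 Ex. 10.6] -/
theorem mem_degZeroMonomialSpan_iff {f : G → ℂ} :
    f ∈ degZeroMonomialSpan G ↔ f ∈ virtChars G ∧ f 1 = 0 :=
  ⟨fun h => ⟨mem_virtChars_of_mem_degZeroMonomialSpan h,
    apply_one_eq_zero_of_mem_degZeroMonomialSpan h⟩,
    fun h => mem_degZeroMonomialSpan_of_mem_virtChars h.1 h.2⟩

/-- `f` **has a degree-zero monomial form**: `f = ∑ᵢ nᵢ · Ind_{Hᵢ}^G (αᵢ - 1)` for finitely many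
subgroups `Hᵢ`, characters `αᵢ : Hᵢ →* ℂˣ` of degree `1` and integers `nᵢ`. [cite: SerreLinearRepresentations1977, §10.5 Ex. 10.6] -/
def HasDegZeroMonomialForm (f : G → ℂ) : Prop :=
  ∃ (ι : Type) (_ : Fintype ι) (H : ι → Subgroup G) (α : ∀ i, H i →* ℂˣ) (n : ι → ℤ),
    f = ∑ i, (n i : ℂ) • indClassFun (H i) (fun h => (α i h : ℂ) - 1)

/-- Elements of `R'₀(G)` have a degree-zero monomial form (unfolding the additive closure into a
finite `ℤ`-combination). [folklore] -/
theorem hasDegZeroMonomialForm_of_mem {f : G → ℂ} (hf : f ∈ degZeroMonomialSpan G) :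
    HasDegZeroMonomialForm f := by
  refine AddSubgroup.closure_induction (p := fun g _ => HasDegZeroMonomialForm g) ?_ ?_ ?_ ?_ hf
  · rintro g ⟨H, α, rfl⟩
    refine ⟨Unit, inferInstance, fun _ => H, fun _ => α, fun _ => 1, ?_⟩
    simp
  · exact ⟨PEmpty, inferInstance, fun i => i.elim, fun i => i.elim, fun i => i.elim,
      (Fintype.sum_empty _).symm⟩
  · rintro g g' _ _ ⟨ι, _, H, α, n, rfl⟩ ⟨κ, _, H', α', n', rfl⟩
    refine ⟨ι ⊕ κ, inferInstance, Sum.elim H H', fun i => match i with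
      | Sum.inl i => α i
      | Sum.inr j => α' j, Sum.elim n n', ?_⟩
    rw [Fintype.sum_sum_type]
    rfl
  · rintro g _ ⟨ι, _, H, α, n, rfl⟩
    refine ⟨ι, inferInstance, H, α, fun i => -n i, ?_⟩
    simp only [Int.cast_neg, neg_smul, Finset.sum_neg_distrib]

/-- **Serre, §10.5 Exercise 10.6, as printed (finite `ℤ`-combination form)**: each `f ∈ R(G)`
with `f(1) = 0` is `f = ∑ᵢ nᵢ · Ind_{Hᵢ}^G (αᵢ - 1)` with `Hᵢ ≤ G`, `αᵢ` characters of degree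
`1` of `Hᵢ`, `nᵢ ∈ ℤ` (here the `Hᵢ` are arbitrary subgroups; Serre: elementary).
[cite: SerreLinearRepresentations1977, §10.5 Ex. 10.6] -/
theorem exists_sum_indClassFun_sub_one {f : G → ℂ} (hf : f ∈ virtChars G) (h1 : f 1 = 0) :
    ∃ (ι : Type) (_ : Fintype ι) (H : ι → Subgroup G) (α : ∀ i, H i →* ℂˣ) (n : ι → ℤ),
      f = ∑ i, (n i : ℂ) • indClassFun (H i) (fun h => (α i h : ℂ) - 1) :=
  hasDegZeroMonomialForm_of_mem (mem_degZeroMonomialSpan_of_mem_virtChars hf h1)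

/-- In particular for a character `χ` of `G`: `χ - χ(1) · 1 = ∑ᵢ nᵢ · Ind_{Hᵢ}^G (αᵢ - 1)`, the
form in which the statement enters the uniqueness of local constants (a representation minus
its dimension times the trivial one is an integral combination of degree-`0` virtual
representations induced from characters). [cite: SerreLinearRepresentations1977, §10.5 Ex. 10.6] -/
theorem exists_sum_indClassFun_sub_one_of_isCharacter {χ : G → ℂ} (hχ : IsCharacter G χ) :
    ∃ (ι : Type) (_ : Fintype ι) (H : ι → Subgroup G) (α : ∀ i, H i →* ℂˣ) (n : ι → ℤ),
      (fun g => χ g - χ 1) = ∑ i, (n i : ℂ) • indClassFun (H i) (fun h => (α i h : ℂ) - 1) := by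
  refine exists_sum_indClassFun_sub_one (f := fun g => χ g - χ 1) ?_ (sub_self _)
  have : (fun g => χ g - χ 1) = χ - (χ 1) • (1 : G → ℂ) := by
    funext g; simp
  rw [this]
  obtain ⟨k, hk⟩ := exists_int_apply_one_of_mem_virtChars hχ.mem_virtChars
  rw [hk, Int.cast_smul_eq_zsmul]
  exact Subring.sub_mem _ hχ.mem_virtChars (Subring.zsmul_mem _ (Subring.one_mem _) k)

end Main

end Literature.RepresentationTheory.FiniteGroups

end
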